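import Mathlib
import HarnessLib
import Literature.Probability.LatticeModels.LatticeGraph

/-!
# LatticeQCDFlow / Scaling — axis lines of the discrete torus `(ℤ/L)^d`: mixed lines lie below
# the vertex boundary; slicing identities for the induction on the dimension

HONEST FRAMING: exact (Metropolis-corrected) sampling algorithms for lattice gauge theory;
figures of merit are autocorrelation/cost numbers at stated couplings and volumes; no
continuum-physics claim.

Venture `LatticeQCDFlow` (cell pub-lqcd), topic `Scaling`, FANOUT row 30 (lean-1) — OUR WORK, file 2
of the AUTOREGRESSIVE-CONTEXT (ELIMINATION-FRONT) VOLUME LAW.  Vocabulary of the tree: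
`Literature.Probability.LatticeModels.{TorusSite, torusGraph, outerBoundary}` (the nearest-neighbour
graph on `(ℤ/L)^d = Fin d → ZMod L` and the outer vertex boundary `∂A` of a finite vertex set).
The isoperimetric inequality on the torus (sequel `Scaling/TorusIsoperimetry.lean`) counts, for a
vertex set `A` and an axis `μ`, the `μ`-LINES `{update x μ t | t}` that meet both `A` and its
complement ("mixed lines"); this file supplies the two ingredients that do not depend on the
induction:

* `lineBase μ x = update x μ 0` (the base point of the `μ`-line through `x`), `mixedLines μ A`
  (the base points of the mixed `μ`-lines, a `Finset`);
* **`card_mixedLines_le_card_outerBoundary`** — for `L ≥ 2` every mixed line carries a vertex of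
  `∂A` (walk along the cyclic line from a point of `A` to the first point outside), and distinct
  lines are disjoint: `#mixed_μ(A) ≤ |∂A|`;
* slicing along the coordinate `0` of `(ℤ/L)^{d+1} = (ℤ/L) × (ℤ/L)^d` (`Fin.cons` / `Fin.tail`):
  `slice h A ⊆ (ℤ/L)^d`, **`sum_card_slice`** (`Σ_h |A_h| = |A|`),
  **`sum_card_mixedLines_slice_le`** (`Σ_h #mixed_μ(A_h) ≤ #mixed_{μ+1}(A)`: a line inside the
  slice `h` mixed for `A_h` is a line of the big torus mixed for `A`), and
  **`card_slice_sub_card_slice_le_mixedLines_zero`** (`|A_{h₁}| - |A_{h₀}| ≤ #mixed_0(A)`: the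
  vertical line over `q ∈ A_{h₁} \\ A_{h₀}` is mixed).
Elementary; nothing is cited as a fact; `def`s `lineBase`, `mixedLines`, `slice`; no `sorry`.
-/

namespace Summit.Ventures.LatticeQCDFlow.Theory2.Autoregressive

open Finset Function
open Literature.Probability.LatticeModels (TorusSite torusGraph torusGraph_adj_iff outerBoundary
  mem_outerBoundary_iff)

variable {d L : ℕ}

/-! ## 1. Lines and mixed lines -/

/-- The base point of the `μ`-line through `x`: the `μ`-coordinate set to `0`. [folklore] -/
def lineBase (μ : Fin d) (x : TorusSite d L) : TorusSite d L :=
  update x μ 0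

/-- The base points of the MIXED `μ`-lines of `A`: lines `{update x μ t | t}` meeting both `A` and
its complement. [folklore] -/
noncomputable def mixedLines [NeZero L] (μ : Fin d) (A : Finset (TorusSite d L)) :
    Finset (TorusSite d L) := by
  classical
  exact (A.filter fun x => ∃ t : ZMod L, update x μ t ∉ A).image (lineBase μ)

/-- `lineBase` is idempotent along the line: `lineBase μ (update x μ t) = lineBase μ x`.
[folklore] -/
@[simp] theorem lineBase_update (μ : Fin d) (x : TorusSite d L) (t : ZMod L) :
    lineBase μ (update x μ t) = lineBase μ x := by
  simp [lineBase]

/-- The line is recovered from its base point: `update (lineBase μ x) μ t = update x μ t`.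
[folklore] -/
@[simp] theorem update_lineBase (μ : Fin d) (x : TorusSite d L) (t : ZMod L) :
    update (lineBase μ x) μ t = update x μ t := by
  simp [lineBase]

/-- Membership in `mixedLines`. [folklore] -/
theorem mem_mixedLines_iff [NeZero L] {μ : Fin d} {A : Finset (TorusSite d L)}
    {b : TorusSite d L} :
    b ∈ mixedLines μ A ↔ ∃ x ∈ A, (∃ t : ZMod L, update x μ t ∉ A) ∧ lineBase μ x = b := by
  classical
  unfold mixedLines
  simp only [mem_image, mem_filter, and_assoc]

/-- A point of `A` whose line leaves `A` contributes its base point to `mixedLines`. [folklore] -/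
theorem lineBase_mem_mixedLines [NeZero L] {μ : Fin d} {A : Finset (TorusSite d L)}
    {x : TorusSite d L} (hx : x ∈ A) {t : ZMod L} (ht : update x μ t ∉ A) :
    lineBase μ x ∈ mixedLines μ A :=
  mem_mixedLines_iff.mpr ⟨x, hx, ⟨t, ht⟩, rfl⟩

/-- One step along a `μ`-line is an edge of the torus graph (`L ≥ 2`). [folklore] -/
theorem torusGraph_adj_update_succ (hL : 2 ≤ L) (μ : Fin d) (x : TorusSite d L) (r : ZMod L) :
    (torusGraph d L).Adj (update x μ r) (update x μ (r + 1)) := by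
  have hstep : update x μ (r + 1) = update x μ r + Pi.single μ (1 : ZMod L) := by
    funext ν
    by_cases hν : ν = μ
    · subst hν; simp
    · simp [update_of_ne hν, Pi.single_eq_of_ne hν]
  refine (torusGraph_adj_iff _ _).mpr ⟨fun h => ?_, Or.inl ⟨μ, hstep⟩⟩
  have h1 : (update x μ r) μ = (update x μ (r + 1)) μ := by rw [h]
  simp only [update_self] at h1
  haveI : Fact (1 < L) := ⟨hL⟩
  exact one_ne_zero (add_left_cancel (a := r) (b := (0 : ZMod L)) (c := 1)
    (by rw [add_zero]; exact h1)).symm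

/-- Walking along a cyclic line from a point of `A` towards a point outside `A` one meets a LAST
point of `A`: some `r` with `update b μ r ∈ A`, `update b μ (r+1) ∉ A`. [folklore] -/
theorem exists_exit_step [NeZero L] {μ : Fin d} {A : Finset (TorusSite d L)} {b : TorusSite d L}
    {s t : ZMod L} (hs : update b μ s ∈ A) (ht : update b μ t ∉ A) :
    ∃ r : ZMod L, update b μ r ∈ A ∧ update b μ (r + 1) ∉ A := by
  by_contra H
  push Not at H
  have hall : ∀ k : ℕ, update b μ (s + k) ∈ A := by
    intro k
    induction k with
    | zero => simpa using hs
    | succ k ih =>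
      have := H _ ih
      simpa [Nat.cast_succ, add_assoc] using this
  have := hall (t - s).val
  rw [ZMod.natCast_zmod_val, add_sub_cancel] at this
  exact ht this

/-- **Every mixed line carries a boundary vertex, and distinct lines are disjoint**:
`#mixed_μ(A) ≤ |∂A|` (`L ≥ 2`). [folklore] -/
theorem card_mixedLines_le_card_outerBoundary [NeZero L] (hL : 2 ≤ L) (μ : Fin d)
    (A : Finset (TorusSite d L)) :
    (mixedLines μ A).card ≤ (outerBoundary (torusGraph d L) A).card := by
  classical
  -- every base point of a mixed line is the base point of a boundary vertex on that line
  have hsub : mixedLines μ A ⊆ (outerBoundary (torusGraph d L) A).image (lineBase μ) := by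
    intro b hb
    obtain ⟨x, hx, ⟨t, ht⟩, rfl⟩ := mem_mixedLines_iff.mp hb
    have hs : update (lineBase μ x) μ (x μ) ∈ A := by simpa using hx
    have ht' : update (lineBase μ x) μ t ∉ A := by simpa using ht
    obtain ⟨r, hr, hr1⟩ := exists_exit_step hs ht'
    refine mem_image.mpr ⟨update (lineBase μ x) μ (r + 1), ?_, by simp⟩
    rw [mem_outerBoundary_iff]
    exact ⟨hr1, _, hr, (torusGraph_adj_update_succ hL μ _ r).symm⟩
  exact (card_le_card hsub).trans card_image_le

/-! ## 2. Slicing `(ℤ/L)^{d+1}` along the coordinate `0` -/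

/-- The slice of `A ⊆ (ℤ/L)^{d+1}` at height `h` (coordinate `0`), as a subset of `(ℤ/L)^d`.
[folklore] -/
def slice [NeZero L] (h : ZMod L) (A : Finset (TorusSite (d + 1) L)) : Finset (TorusSite d L) :=
  (A.filter fun x => x 0 = h).image Fin.tail

/-- Membership in a slice: `q ∈ A_h ↔ cons h q ∈ A`. [folklore] -/
@[simp] theorem mem_slice_iff [NeZero L] {h : ZMod L} {A : Finset (TorusSite (d + 1) L)}
    {q : TorusSite d L} : q ∈ slice h A ↔ (Fin.cons h q : TorusSite (d + 1) L) ∈ A := by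
  unfold slice
  simp only [mem_image, mem_filter]
  constructor
  · rintro ⟨x, ⟨hx, rfl⟩, rfl⟩
    rwa [Fin.cons_self_tail]
  · intro hq
    exact ⟨Fin.cons h q, ⟨hq, by simp⟩, by simp⟩

/-- The slice at `h` is in bijection (by `Fin.cons h`) with the fibre of `A` over `h`. [folklore] -/
theorem card_slice [NeZero L] (h : ZMod L) (A : Finset (TorusSite (d + 1) L)) :
    (slice h A).card = (A.filter fun x => x 0 = h).card := by
  unfold slice
  refine card_image_of_injOn fun x hx y hy hxy => ?_
  rw [mem_coe, mem_filter] at hx hy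
  rw [← Fin.cons_self_tail x, ← Fin.cons_self_tail y, hx.2, hy.2, hxy]

/-- **`Σ_h |A_h| = |A|`.** [folklore] -/
theorem sum_card_slice [NeZero L] (A : Finset (TorusSite (d + 1) L)) :
    ∑ h : ZMod L, (slice h A).card = A.card := by
  simp_rw [card_slice]
  exact (card_eq_sum_card_fiberwise (f := fun x : TorusSite (d + 1) L => x 0) (s := A)
    (t := (univ : Finset (ZMod L))) fun _ _ => mem_univ _).symm

/-- A line inside the slice `h`, mixed for `A_h`, is (after `Fin.cons h`) a line of the big torus
mixed for `A`. [folklore] -/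
theorem cons_mem_mixedLines_succ [NeZero L] {h : ZMod L} {A : Finset (TorusSite (d + 1) L)}
    {μ : Fin d} {b : TorusSite d L} (hb : b ∈ mixedLines μ (slice h A)) :
    (Fin.cons h b : TorusSite (d + 1) L) ∈ mixedLines μ.succ A := by
  obtain ⟨q, hq, ⟨t, ht⟩, rfl⟩ := mem_mixedLines_iff.mp hb
  rw [mem_slice_iff] at hq
  rw [mem_slice_iff, Fin.cons_update] at ht
  refine mem_mixedLines_iff.mpr ⟨Fin.cons h q, hq, ⟨t, ht⟩, ?_⟩
  simp only [lineBase, ← Fin.cons_update]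

/-- **`Σ_h #mixed_μ(A_h) ≤ #mixed_{μ+1}(A)`.** [folklore] -/
theorem sum_card_mixedLines_slice_le [NeZero L] (A : Finset (TorusSite (d + 1) L)) (μ : Fin d) :
    ∑ h : ZMod L, (mixedLines μ (slice h A)).card ≤ (mixedLines μ.succ A).card := by
  classical
  have hinj : ∀ h : ZMod L, Set.InjOn (fun b : TorusSite d L => (Fin.cons h b : TorusSite (d + 1) L))
      ↑(mixedLines μ (slice h A)) := fun h x _ y _ hxy => (Fin.cons_inj.mp hxy).2
  calc ∑ h : ZMod L, (mixedLines μ (slice h A)).card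
      = ∑ h : ZMod L, ((mixedLines μ (slice h A)).image fun b =>
          (Fin.cons h b : TorusSite (d + 1) L)).card := by
        refine sum_congr rfl fun h _ => (card_image_of_injOn (hinj h)).symm
    _ = ((univ : Finset (ZMod L)).biUnion fun h => (mixedLines μ (slice h A)).image fun b =>
          (Fin.cons h b : TorusSite (d + 1) L)).card := by
        refine (card_biUnion fun h _ h' _ hne => ?_).symm
        rw [Function.onFun, disjoint_left]
        intro x hx hx'
        obtain ⟨b, -, rfl⟩ := mem_image.mp hx
        obtain ⟨b', -, hb'⟩ := mem_image.mp hx'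
        exact hne (Fin.cons_inj.mp hb').1.symm
    _ ≤ (mixedLines μ.succ A).card := by
        refine card_le_card fun x hx => ?_
        obtain ⟨h, -, hx⟩ := mem_biUnion.mp hx
        obtain ⟨b, hb, rfl⟩ := mem_image.mp hx
        exact cons_mem_mixedLines_succ hb

/-- **`|A_{h₁}| - |A_{h₀}| ≤ #mixed_0(A)`**: the vertical line over `q ∈ A_{h₁} \\ A_{h₀}` is mixed.
[folklore] -/
theorem card_slice_sub_card_slice_le_mixedLines_zero [NeZero L] (A : Finset (TorusSite (d + 1) L))
    (h₀ h₁ : ZMod L) :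
    (slice h₁ A).card - (slice h₀ A).card ≤ (mixedLines 0 A).card := by
  classical
  calc (slice h₁ A).card - (slice h₀ A).card
      ≤ (slice h₁ A \ slice h₀ A).card := le_card_sdiff (slice h₀ A) (slice h₁ A)
    _ = ((slice h₁ A \ slice h₀ A).image fun q =>
          (Fin.cons (0 : ZMod L) q : TorusSite (d + 1) L)).card := by
        rw [card_image_of_injOn]
        exact fun x _ y _ hxy => (Fin.cons_inj.mp hxy).2
    _ ≤ (mixedLines 0 A).card := by
        refine card_le_card fun x hx => ?_
        obtain ⟨q, hq, rfl⟩ := mem_image.mp hx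
        rw [mem_sdiff, mem_slice_iff, mem_slice_iff] at hq
        have hb : lineBase 0 (Fin.cons h₁ q : TorusSite (d + 1) L) = Fin.cons (0 : ZMod L) q := by
          simp [lineBase, Fin.update_cons_zero]
        rw [← hb]
        exact lineBase_mem_mixedLines hq.1 (t := h₀) (by simpa [Fin.update_cons_zero] using hq.2)

end Summit.Ventures.LatticeQCDFlow.Theory2.Autoregressive
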